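import Mathlib
import Literature.MathematicalPhysics.QuantumFieldTheory.Balaban1983to89.B13PerturbativeStep
import Summits.QuantumFields.BalabanUV.Beta.CovariantTowerL2

/-!
# Beta / CovariantTowerMatrix — the bridge from the pv21 MODEL's real endomorphisms `Module.End ℝ (Y → ℝ)` to the
# complex MATRIX currency `Matrix Y Y ℂ` of the row-D4 chains (`B13PerturbativeStep.WRS`, d4-p3's
# `UnitLatticeWalkInversion`, an4's `AnalyticWalkSum216RowData.RowData`): `cmat A i j = A(δ_j)(i)` is a ring
# homomorphism, sends multiplication operators to diagonal matrices, transports inverses, and its entries are bounded by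
# any ℓ² operator bound (unit `b2b-balaban-beta-d4-p2`, GEN 5; first module of the chain
# `CovariantTowerMatrix → CovariantTowerLocal → CovariantTowerWRS → CovariantTowerRowData`)

HONEST FRAMING: discharging `BetaPertH` makes Bałaban's UV stability UNCONDITIONAL — NOT the continuum limit, NOT the
Clay problem.  HONEST DEPENDENCY (verbatim): «continuum YM on T⁴ ⇐ BetaPertH ∧ nine spine estimates (0/9 proved);
BetaPertH ⇐ (D1) ∧ (D4) ∧ CAP+tail; G-an2-4 gates asym, D1 and NE2/3/4.»  THIS MODULE DISCHARGES NOTHING of `BetaPertH`,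
asserts NOTHING printed and cites nothing as a fact (ABSOLUTE RULE): [folklore] finite-dimensional linear algebra.  WHY: the
general-U operator layer of NODE O.2 (pv21's `B9Thm37GlueTorusCov*`, this unit's `CovariantTower*`) is written in
`Module.End ℝ (St × Cp → ℝ)`; NODE A's chain (an4's `AnalyticWalkSum216Row*`, d4-p3's `UnitLattice*`) is written in
`Matrix Y Y ℂ` with weighted row sums `WRS κ d`.  The junction O.2 → A needs exactly this dictionary and nothing else.

CONTENT ([folklore]; `Y` a finite type with decidable equality).
* §1 `cmat A := (LinearMap.toMatrix' A).map ofReal`, `cmat_apply` (`= A (Pi.single j 1) i`), `cmat_mul`, `cmat_one`,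
  `cmat_add`, `cmat_sub`, `cmat_sum`, `cmat_smul`, `cmat_pow`; `cmat_mulOp` (= `Matrix.diagonal`), `cmat_apply_vec`
  (`(A v)(i) = Σ_j Re-entries · v j`).
* §2 inverses: `cmat_inv_of_mul_eq_one` (A·G = 1 ⇒ (cmat A)⁻¹ = cmat G and `IsUnit (cmat A)`).
* §3 sizes: `abs_apply_single_le_of_l2Bound` (|A(δ_j)(i)| ≤ C from `L2Bound A C`), `norm_cmat_le_of_l2Bound`;
  `wrs_cmat_eq` (the weighted row sum of `cmat A` is `Σ_j |A(δ_j)(i)|·e^{κ d(i,j)}`).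
NOT HERE: anything about the tower (siblings).  Row D4: infrastructure of the O.2 → A junction; class of (T3)/NODE O.2
unchanged; D4 DISCHARGE NO DATE; NOT BetaPertH, NOT continuum, NOT Clay.
-/

namespace Summit.QuantumFields.BalabanUV.Beta.CovariantTowerMatrix

open Finset
open Literature.MathematicalPhysics.QuantumFieldTheory.Balaban1983to89
open B9Thm37Sum (mulOp mulOp_apply)
open B13PerturbativeStep (WRS wrs)
open Summit.QuantumFields.BalabanUV.Beta.CovariantTowerL2 (L2Bound)

noncomputable section

variable {Y : Type} [Fintype Y] [DecidableEq Y]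

/-! ## §1  The complex matrix of a real endomorphism -/

/-- MODEL bookkeeping: **the complex matrix of a real endomorphism**, `cmat A i j = A(δ_j)(i)` read in ℂ. [folklore] -/
def cmat (A : Module.End ℝ (Y → ℝ)) : Matrix Y Y ℂ := (LinearMap.toMatrix' A).map Complex.ofRealHom

/-- Entries: `cmat A i j = ((A (Pi.single j 1) i : ℝ) : ℂ)`. [folklore] -/
theorem cmat_apply (A : Module.End ℝ (Y → ℝ)) (i j : Y) : cmat A i j = ((A (Pi.single j 1) i : ℝ) : ℂ) := rfl

/-- `cmat` is multiplicative. [folklore] -/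
theorem cmat_mul (A B : Module.End ℝ (Y → ℝ)) : cmat (A * B) = cmat A * cmat B := by
  rw [cmat, LinearMap.toMatrix'_mul, Matrix.map_mul]; rfl

/-- `cmat 1 = 1`. [folklore] -/
theorem cmat_one : cmat (1 : Module.End ℝ (Y → ℝ)) = 1 := by
  rw [cmat, LinearMap.toMatrix'_one, Matrix.map_one _ (map_zero _) (map_one _)]

/-- `cmat` is additive. [folklore] -/
theorem cmat_add (A B : Module.End ℝ (Y → ℝ)) : cmat (A + B) = cmat A + cmat B := by
  ext i j
  simp only [cmat_apply, LinearMap.add_apply, Pi.add_apply, Complex.ofReal_add, Matrix.add_apply]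

/-- `cmat` respects subtraction. [folklore] -/
theorem cmat_sub (A B : Module.End ℝ (Y → ℝ)) : cmat (A - B) = cmat A - cmat B := by
  ext i j
  simp only [cmat_apply, LinearMap.sub_apply, Pi.sub_apply, Complex.ofReal_sub, Matrix.sub_apply]

/-- `cmat 0 = 0`. [folklore] -/
theorem cmat_zero : cmat (0 : Module.End ℝ (Y → ℝ)) = 0 := by
  ext i j; simp [cmat_apply]

/-- `cmat` as a ring homomorphism. [folklore] -/
def cmatHom : Module.End ℝ (Y → ℝ) →+* Matrix Y Y ℂ where
  toFun := cmat
  map_one' := cmat_one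
  map_mul' := cmat_mul
  map_zero' := cmat_zero
  map_add' := cmat_add

/-- Unfolding of `cmatHom`. [folklore] -/
@[simp] theorem cmatHom_apply (A : Module.End ℝ (Y → ℝ)) : cmatHom A = cmat A := rfl

/-- `cmat` of a finite sum. [folklore] -/
theorem cmat_sum {ι : Type} (s : Finset ι) (A : ι → Module.End ℝ (Y → ℝ)) :
    cmat (∑ z ∈ s, A z) = ∑ z ∈ s, cmat (A z) := by
  rw [← cmatHom_apply, map_sum]; rfl

/-- `cmat` of a power. [folklore] -/
theorem cmat_pow (A : Module.End ℝ (Y → ℝ)) (n : ℕ) : cmat (A ^ n) = cmat A ^ n := by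
  rw [← cmatHom_apply, map_pow]; rfl

/-- `cmat` of a real scalar multiple. [folklore] -/
theorem cmat_smul (r : ℝ) (A : Module.End ℝ (Y → ℝ)) : cmat (r • A) = (r : ℂ) • cmat A := by
  ext i j
  simp only [cmat_apply, LinearMap.smul_apply, Pi.smul_apply, smul_eq_mul, Matrix.smul_apply, Complex.ofReal_mul]

/-- **Multiplication operators become diagonal matrices**: `cmat (M_χ) = diagonal (χ : ℂ)`. [folklore] -/
theorem cmat_mulOp (χ : Y → ℝ) : cmat (mulOp χ) = Matrix.diagonal fun y => ((χ y : ℝ) : ℂ) := by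
  ext i j
  rw [cmat_apply, mulOp_apply, Matrix.diagonal_apply, Pi.single_apply]
  split_ifs with h
  · subst h; simp
  · simp

/-- The real endomorphism is recovered from the matrix: `(A v)(i) = Σ_j A(δ_j)(i)·v(j)`. [folklore] -/
theorem apply_eq_sum_single (A : Module.End ℝ (Y → ℝ)) (v : Y → ℝ) (i : Y) :
    A v i = ∑ j, A (Pi.single j 1) i * v j := by
  have hv : v = ∑ j, v j • (Pi.single j (1 : ℝ) : Y → ℝ) := by
    ext y
    simp only [Finset.sum_apply, Pi.smul_apply, Pi.single_apply, smul_eq_mul, mul_ite, mul_one, mul_zero,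
      Finset.sum_ite_eq, Finset.mem_univ, if_true]
  conv_lhs => rw [hv]
  rw [map_sum, Finset.sum_apply]
  exact Finset.sum_congr rfl fun j _ => by rw [map_smul, Pi.smul_apply, smul_eq_mul, mul_comm]

/-! ## §2  Inverses -/

/-- **A right inverse in `Module.End` gives the matrix inverse**: `A·G = 1 ⇒ IsUnit (cmat A) ∧ (cmat A)⁻¹ = cmat G`. [folklore] -/
theorem cmat_inv_of_mul_eq_one {A G : Module.End ℝ (Y → ℝ)} (h : A * G = 1) :
    IsUnit (cmat A) ∧ (cmat A)⁻¹ = cmat G := by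
  have hright : cmat A * cmat G = 1 := by rw [← cmat_mul, h, cmat_one]
  exact ⟨(Matrix.isUnit_iff_isUnit_det _).2 (Matrix.isUnit_det_of_right_inverse hright),
    Matrix.inv_eq_right_inv hright⟩

/-- **`Ring.inverse` transports**: if `A` is a unit then `cmat (Ring.inverse A) = (cmat A)⁻¹`. [folklore] -/
theorem cmat_ringInverse {A : Module.End ℝ (Y → ℝ)} (hA : IsUnit A) : cmat (Ring.inverse A) = (cmat A)⁻¹ :=
  (cmat_inv_of_mul_eq_one (Ring.mul_inverse_cancel A hA)).2.symm

/-! ## §3  Sizes: entries from ℓ² bounds, weighted row sums -/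

omit [DecidableEq Y] in
/-- One coordinate is bounded by the ℓ² norm: `(w i)² ≤ Σ_y (w y)²`. [folklore] -/
theorem sq_apply_le_sum_sq (w : Y → ℝ) (i : Y) : w i ^ 2 ≤ ∑ y, w y ^ 2 :=
  Finset.single_le_sum (f := fun y => w y ^ 2) (fun y _ => sq_nonneg (w y)) (Finset.mem_univ i)

/-- The unit vector has ℓ² norm one: `Σ_y δ_j(y)² = 1`. [folklore] -/
theorem sum_single_sq (j : Y) : ∑ y, (Pi.single j (1 : ℝ) : Y → ℝ) y ^ 2 = 1 := by
  simp [Pi.single_apply, Finset.sum_ite_eq']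

/-- **Entries are bounded by any ℓ² operator bound**: `L2Bound A C ⇒ |A(δ_j)(i)| ≤ C`. [folklore] -/
theorem abs_apply_single_le_of_l2Bound {A : Module.End ℝ (Y → ℝ)} {C : ℝ} (hA : L2Bound A C) (i j : Y) :
    |A (Pi.single j 1) i| ≤ C := by
  have h1 : A (Pi.single j 1) i ^ 2 ≤ C ^ 2 := by
    calc A (Pi.single j 1) i ^ 2 ≤ ∑ y, A (Pi.single j 1) y ^ 2 := sq_apply_le_sum_sq _ i
      _ ≤ C ^ 2 * ∑ y, (Pi.single j (1 : ℝ) : Y → ℝ) y ^ 2 := hA.2 _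
      _ = C ^ 2 := by rw [sum_single_sq, mul_one]
  exact abs_le_of_sq_le_sq' h1 hA.1 |>.elim (fun h h' => abs_le.mpr ⟨h, h'⟩)

/-- … in the complex matrix currency: `‖cmat A i j‖ ≤ C`. [folklore] -/
theorem norm_cmat_le_of_l2Bound {A : Module.End ℝ (Y → ℝ)} {C : ℝ} (hA : L2Bound A C) (i j : Y) :
    ‖cmat A i j‖ ≤ C := by
  rw [cmat_apply, Complex.norm_real, Real.norm_eq_abs]
  exact abs_apply_single_le_of_l2Bound hA i j

/-- The norm of an entry of `cmat A` is the absolute value of the real entry. [folklore] -/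
theorem norm_cmat_apply (A : Module.End ℝ (Y → ℝ)) (i j : Y) : ‖cmat A i j‖ = |A (Pi.single j 1) i| := by
  rw [cmat_apply, Complex.norm_real, Real.norm_eq_abs]

/-- **The weighted row sum of `cmat A`** is `Σ_j |A(δ_j)(i)|·e^{κ d(i,j)}`. [folklore] -/
theorem wrs_cmat_eq (κ : ℝ) (d : Y → Y → ℝ) (A : Module.End ℝ (Y → ℝ)) (i : Y) :
    wrs κ d (cmat A) i = ∑ j, |A (Pi.single j 1) i| * Real.exp (κ * d i j) := by
  unfold wrs
  exact Finset.sum_congr rfl fun j _ => by rw [norm_cmat_apply]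

/-- **WRS transfer**: a bound on the real weighted row sums of `A` is a `WRS` bound for `cmat A`. [folklore] -/
theorem wrs_cmat_of_real {κ : ℝ} {d : Y → Y → ℝ} {A : Module.End ℝ (Y → ℝ)} {ρ : ℝ}
    (h : ∀ i, ∑ j, |A (Pi.single j 1) i| * Real.exp (κ * d i j) ≤ ρ) : WRS κ d (cmat A) ρ := fun i => by
  rw [wrs_cmat_eq]; exact h i

/-- Entries of a product vanish unless an intermediate index connects: if `A(δ_m)(i) = 0` for all `m ∉ S` then
`(A·B)(δ_j)(i) = Σ_{m ∈ S} A(δ_m)(i)·B(δ_j)(m)`. [folklore] -/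
theorem mul_apply_single_eq_sum_filter (A B : Module.End ℝ (Y → ℝ)) (S : Finset Y) (i j : Y)
    (hA : ∀ m, m ∉ S → A (Pi.single m 1) i = 0) :
    (A * B) (Pi.single j 1) i = ∑ m ∈ S, A (Pi.single m 1) i * B (Pi.single j 1) m := by
  rw [Module.End.mul_apply, apply_eq_sum_single]
  symm
  refine Finset.sum_subset (Finset.subset_univ S) fun m _ hm => ?_
  rw [hA m hm, zero_mul]

end

end Summit.QuantumFields.BalabanUV.Beta.CovariantTowerMatrix
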